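import Literature.AlgebraicGeometry.RelativeSpec.FiniteGroupQuotient
import Literature.AlgebraicGeometry.Motives.Varieties
import Mathlib.CategoryTheory.Monoidal.Cartesian.Over
import HarnessLib

/-!
# Actions of a group over a base: `Over`-automorphisms and base change along `P ×_R Q → Q`

Topic `Literature/AlgebraicGeometry/RelativeSpec`. Definitions + proved API (no named fact). Written by the prover seat
`hodge-nonav-prover-Bx` (g19, cell `hodge-nonav`), programme M1 (memo `PROGRAMME-M1-Bx-g19.md`) for route
`HodgeConjecture/Q8SymplecticPowers` (crux K1Q, stmt-HodgeConjecture-24190); route-agnostic plumbing for the tree's action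
datum `RelativeSpec.ActionOver` (SGA 3 / SGA 1 Exp. V §1):

* `ActionOver.overAut ρ g : P ≅ P` — the automorphism `ρ(g)` as an isomorphism in `SchemeOver R = Over (Spec R)`,
  with `overAut_one_hom`, `overAut_mul_hom`;
* `ActionOver.tensorRight ρ Q : ActionOver (snd P Q).left G` — the BASE-CHANGED action on `P ×_R Q` over `Q`
  (`g ↦ ρ(g) ▷ Q`, whiskering in the cartesian monoidal structure of `Over (Spec R)`), with `tensorRight_aut_hom`
  (`= (ρ(g) ▷ Q).left = pullback.map _ _ _ _ ρ(g) (𝟙 _) (𝟙 _)`, Mathlib `Over.whiskerRight_left`) and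
  `tensorRight_aut_hom_fst` (it lies over `ρ(g)` along the first projection).

## References

* [SGA1] A. Grothendieck, SGA 1, Exp. V §1 (actions over a base, base change).
* [MumfordAV1970] D. Mumford, Abelian Varieties (1970), §7.
-/

noncomputable section

open CategoryTheory CategoryTheory.Limits AlgebraicGeometry MonoidalCategory CartesianMonoidalCategory

universe u

/-! ### Actions over a base: `Over`-automorphisms and base change -/

namespace Literature.AlgebraicGeometry.RelativeSpec.ActionOver

open Literature.AlgebraicGeometry.Motives

variable {R : Type u} [CommRing R] {P : SchemeOver R} {G : Type*} [Group G] (ρ : ActionOver P.hom G)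

/-- The automorphism `ρ(g)` as an isomorphism of `R`-schemes (it commutes with `P → Spec R`).
[cite: SGA1, Exp. V §1] -/
def overAut (g : G) : P ≅ P := Over.isoMk (ρ.aut g) (ρ.aut_comp g)

/-- The underlying automorphism of `overAut g` is `ρ(g)`. [cite: SGA1, Exp. V §1] -/
@[simp] theorem overAut_hom_left (g : G) : (ρ.overAut g).hom.left = (ρ.aut g).hom := rfl

/-- `overAut 1 = 𝟙`. [cite: SGA1, Exp. V §1] -/
theorem overAut_one_hom : (ρ.overAut 1).hom = 𝟙 P := by
  ext : 1
  rw [overAut_hom_left, map_one, Over.id_left]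
  rfl

/-- `overAut (g h) = overAut h ≫ overAut g` (Mathlib's `Aut` multiplies by `f * g = g ≫ f`). [cite: SGA1, Exp. V §1] -/
theorem overAut_mul_hom (g h : G) : (ρ.overAut (g * h)).hom = (ρ.overAut h).hom ≫ (ρ.overAut g).hom := by
  ext : 1
  rw [overAut_hom_left, map_mul, Aut.Aut_mul_def, Over.comp_left, overAut_hom_left, overAut_hom_left]
  rfl

/-- **Base change of an action**: `G` acts on `P ×_R Q` over `Q` by `ρ(g) × id` (whiskering in the cartesian
monoidal category `SchemeOver R`). [cite: SGA1, Exp. V §1] -/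
def tensorRight (Q : SchemeOver R) : ActionOver (snd P Q).left G where
  aut :=
    { toFun := fun g => (Over.forget _).mapIso (whiskerRightIso (ρ.overAut g) Q)
      map_one' := by
        ext : 1
        change ((ρ.overAut 1).hom ▷ Q).left = 𝟙 _
        rw [overAut_one_hom, id_whiskerRight]
        rfl
      map_mul' := fun g h => by
        ext : 1
        change ((ρ.overAut (g * h)).hom ▷ Q).left = (((ρ.overAut h).hom ▷ Q) ≫ ((ρ.overAut g).hom ▷ Q)).left
        rw [overAut_mul_hom, comp_whiskerRight] }
  aut_comp g := by
    change ((ρ.overAut g).hom ▷ Q).left ≫ (snd P Q).left = (snd P Q).left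
    rw [← Over.comp_left, whiskerRight_snd]

/-- The base-changed automorphism is `ρ(g) ▷ Q`. [cite: SGA1, Exp. V §1] -/
theorem tensorRight_aut_hom (Q : SchemeOver R) (g : G) :
    ((ρ.tensorRight Q).aut g).hom = ((ρ.overAut g).hom ▷ Q).left := rfl

/-- The base-changed automorphism lies over `ρ(g)` along the first projection. [cite: SGA1, Exp. V §1] -/
theorem tensorRight_aut_hom_fst (Q : SchemeOver R) (g : G) :
    ((ρ.tensorRight Q).aut g).hom ≫ (fst P Q).left = (fst P Q).left ≫ (ρ.aut g).hom := by
  rw [tensorRight_aut_hom, ← Over.comp_left, whiskerRight_fst, Over.comp_left, overAut_hom_left]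

end Literature.AlgebraicGeometry.RelativeSpec.ActionOver

end
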